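import Summits.HubbardSuperconductivity.HubbardSuperconductivity.Theses.FunctionFieldCertificate
import Summits.HubbardSuperconductivity.HubbardSuperconductivity.Theorems.FunctionFieldCertificateCertificateCompletenessCore
import Literature.Barriers.HubbardSuperconductivity.PureModelStripeCompetitionProofs

/-!
# FunctionFieldCertificate / support `CertificateCompleteness` (stmt-HubbardSuperconductivity-7334)

We prove the route item
`Summit.HubbardSuperconductivity.HubbardSuperconductivity.Theses.FunctionFieldCertificate.CertificateCompleteness`:
if at some `(U, δ)` every normalised `(N_L, S^z = 0)`-sector ground state `ψ` of `H_L = hubbardTorus 2 L 1 U`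
has `L⁻⁴ Re⟨ψ, Δ_d†Δ_d ψ⟩ ≥ a` for all large even `L`, then `CertifiedSectorLRO` holds — with the SAME
`U, δ, a, L₀` and slack constant `C = 1`.

Per side `L` (`certificate_at`): with `K = szSector N_L 0` = Lieb's `(n, n)` coordinate block of Fock space
(`mem_szSector_two_mul_zero_iff`), `E₀ = minEnergyOn H_L K`, a normalised sector ground state `φ₀`
(`exists_unit_isGroundStateInSector_hubbardTorus`) and `M = L⁻⁴Δ_d†Δ_d - (a - 1/L)·1`, the core lemma
`FunctionFieldCertificate.exists_certificate_core` (file `…CertificateCompletenessCore`) gives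
`M = O†O + Σ_j Q_j†(H Q_j - Q_j H) + T` with `Q_j = √c·|φ₀⟩⟨e_j|` (range `ℂφ₀ ⊂ K`, so sector-preserving)
and `T` of zero expectation on `K`; we take `R := 0`. Its hypotheses are tree facts: `H_L` is Hermitian and
block diagonal in `(N↑, N↓)` (`LiebThm1.hamiltonian_isHermitian`, `LiebThm1.preservesSectors_hamiltonian`),
the sector variational bound (`szSector_groundState`), and — the only place the item's hypothesis enters —
`Re⟨v, Mv⟩ ≥ 1/L > 0` at every unit sector ground state `v`.

The slack `1/L` (i.e. `C = 1`, allowed by `CertifiedSectorLRO`) is what makes the `R`-channel of the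
planner's sketch unnecessary: with `C = 0` the cross terms between the ground eigenspace and its
complement inside `K` are not controlled by `c (H - E₀)` alone, and one needs `[H, R]` to remove them.

Sources: the "completeness of first-order (KKT) SDP constraints" theme is FawziFawziScalet2024 /
Araújo–Klep–Garner–Navascués et al., FoCM 2026 (doi:10.1007/s10208-026-09761-x), there only
asymptotically in the degree; this exact finite-`L` statement is elementary and apparently unprinted
(grounder note on the item). No definition is introduced.
-/

noncomputable section

-- the problem namespace `HubbardSuperconductivity.HubbardSuperconductivity` repeats a component by design
set_option linter.dupNamespace false

namespace Summit.HubbardSuperconductivity.HubbardSuperconductivity.Theorems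

namespace FunctionFieldCertificate

open Matrix
open scoped Matrix ComplexOrder MatrixOrder

/-! ### The certificate at one side -/

open Literature.MathematicalPhysics.QuantumLattice Literature.Barriers.HubbardSuperconductivity

/-- **The certificate at one side `L`.** If every normalised ground state of `hubbardTorus 2 L 1 U` in
the sector `(2n, S^z = 0)` (`n ≤ L²`) has `Re⟨ψ, Δ_d†Δ_d ψ⟩ / L⁴ ≥ a`, then
`L⁻⁴Δ_d†Δ_d - (a - 1/L)·1 = O†O + Σ_i Q_i†(H Q_i - Q_i H) + (H·0 - 0·H) + T` with sector-preserving
`Q_i` and a sector term `T` (zero expectation on `szSector (2n) 0`): `exists_certificate_core` for the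
`(n, n)` coordinate block (`mem_szSector_two_mul_zero_iff`; `H` Hermitian and block diagonal,
`LiebThm1.hamiltonian_isHermitian`, `LiebThm1.preservesSectors_hamiltonian`; variational bound
`szSector_groundState`; a unit sector ground state `exists_unit_isGroundStateInSector_hubbardTorus`).
[folklore] -/
theorem certificate_at (U a : ℝ) (L : ℕ) [NeZero L] (n : ℕ) (hn : n ≤ L ^ 2)
    (hyp : ∀ ψ : Fock (Orb (FermionTorus 2 L)), star ψ ⬝ᵥ ψ = 1 →
      IsGroundStateInSector (hubbardTorus 2 L 1 U) (2 * n) 0 ψ →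
        a ≤ (star ψ ⬝ᵥ ((pairField dWaveFormFactor L)ᴴ * pairField dWaveFormFactor L) *ᵥ ψ).re /
          (L : ℝ) ^ 4) :
    ∃ (n' m : ℕ)
      (O : Fin n' → Matrix (Finset (Orb (FermionTorus 2 L))) (Finset (Orb (FermionTorus 2 L))) ℂ)
      (Q : Fin m → Matrix (Finset (Orb (FermionTorus 2 L))) (Finset (Orb (FermionTorus 2 L))) ℂ)
      (R T : Matrix (Finset (Orb (FermionTorus 2 L))) (Finset (Orb (FermionTorus 2 L))) ℂ),
      (∀ (i : Fin m) (ψ : Fock (Orb (FermionTorus 2 L))), ψ ∈ szSector (2 * n) 0 →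
        Q i *ᵥ ψ ∈ szSector (2 * n) 0) ∧
      (∀ ψ : Fock (Orb (FermionTorus 2 L)), ψ ∈ szSector (2 * n) 0 → star ψ ⬝ᵥ T *ᵥ ψ = 0) ∧
      (1 / (L : ℂ) ^ 4) • ((pairField dWaveFormFactor L)ᴴ * pairField dWaveFormFactor L) -
          ((a - 1 / (L : ℝ) : ℝ) : ℂ) •
            (1 : Matrix (Finset (Orb (FermionTorus 2 L))) (Finset (Orb (FermionTorus 2 L))) ℂ) =
        ∑ i : Fin n', (O i)ᴴ * O i +
          ∑ i : Fin m, (Q i)ᴴ * (hubbardTorus 2 L 1 U * Q i - Q i * hubbardTorus 2 L 1 U) +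
          (hubbardTorus 2 L 1 U * R - R * hubbardTorus 2 L 1 U) + T := by
  set H := hubbardTorus 2 L 1 U with hH_def
  set M := (1 / (L : ℂ) ^ 4) • ((pairField dWaveFormFactor L)ᴴ * pairField dWaveFormFactor L) -
    ((a - 1 / (L : ℝ) : ℝ) : ℂ) •
      (1 : Matrix (Finset (Orb (FermionTorus 2 L))) (Finset (Orb (FermionTorus 2 L))) ℂ) with hM_def
  set p : Finset (Orb (FermionTorus 2 L)) → Prop := fun s => (upPart s).card = n ∧ (downPart s).card = n
    with hp_def
  have hL : (0 : ℝ) < (L : ℝ) := Nat.cast_pos.mpr (Nat.pos_of_ne_zero (NeZero.ne L))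
  have hcoe : ((1 / (L : ℝ) ^ 4 : ℝ) : ℂ) = 1 / (L : ℂ) ^ 4 := by push_cast; ring
  -- tree facts: Hermitian, block diagonal, sector = Lieb's `(n, n)` block, variational bound, a GS
  have hHerm : H.IsHermitian := LiebThm1.hamiltonian_isHermitian (fermionTorusGraph 2 L) 1 U
  have hPres : PreservesSectors H := LiebThm1.preservesSectors_hamiltonian (fermionTorusGraph 2 L) 1 U
  have hK : ∀ v : Fock (Orb (FermionTorus 2 L)), v ∈ szSector (2 * n) (0 : ℝ) ↔ IsInSector n n v :=
    fun v => mem_szSector_two_mul_zero_iff n v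
  have hcard : n ≤ Fintype.card (FermionTorus 2 L) := by
    simpa [FermionTorus, Fintype.card_fin] using hn
  obtain ⟨-, hvar⟩ := szSector_groundState (fermionTorusGraph 2 L) 1 U hcard
  obtain ⟨u, hu1, hu⟩ := exists_unit_isGroundStateInSector_hubbardTorus U L n hn
  -- the hypotheses of the core lemma
  have hM : M.IsHermitian := by
    refine ((isHermitian_conjTranspose_mul_self _).smul ?_).sub ?_
    · rw [← hcoe]
      exact Complex.conj_ofReal _
    · rw [IsHermitian, conjTranspose_smul, conjTranspose_one, Complex.star_def, Complex.conj_ofReal]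
  have hinv : ∀ v : Fock (Orb (FermionTorus 2 L)), IsInSector n n v → IsInSector n n (H *ᵥ v) :=
    fun v hv => hPres.isInSector_mulVec hv
  have hE : ∀ v : Fock (Orb (FermionTorus 2 L)), IsInSector n n v →
      H.minEnergyOn (szSector (2 * n) 0) * (star v ⬝ᵥ v).re ≤ (star v ⬝ᵥ H *ᵥ v).re :=
    fun v hv => hvar v hv
  have hpos : ∀ v : Fock (Orb (FermionTorus 2 L)), IsInSector n n v → star v ⬝ᵥ v = 1 →
      H *ᵥ v = ((H.minEnergyOn (szSector (2 * n) 0) : ℝ) : ℂ) • v → 0 < (star v ⬝ᵥ M *ᵥ v).re := by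
    intro v hv hv1 hHv
    have hv0 : v ≠ 0 := by
      intro h0
      rw [h0, dotProduct_zero] at hv1
      exact zero_ne_one hv1
    have ha := hyp v hv1 ⟨(hK v).2 hv, hv0, hHv⟩
    have hform : (star v ⬝ᵥ M *ᵥ v).re =
        1 / (L : ℝ) ^ 4 *
            (star v ⬝ᵥ ((pairField dWaveFormFactor L)ᴴ * pairField dWaveFormFactor L) *ᵥ v).re -
          (a - 1 / (L : ℝ)) := by
      rw [hM_def, sub_mulVec, smul_mulVec, smul_mulVec, one_mulVec, dotProduct_sub,
        dotProduct_smul, dotProduct_smul, hv1, smul_eq_mul, smul_eq_mul, mul_one, ← hcoe,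
        Complex.sub_re, Complex.re_ofReal_mul, Complex.ofReal_re]
    rw [hform]
    rw [le_div_iff₀ (by positivity)] at ha
    have h4 : (0 : ℝ) < (L : ℝ) ^ 4 := by positivity
    have : 1 / (L : ℝ) ^ 4 *
        (star v ⬝ᵥ ((pairField dWaveFormFactor L)ᴴ * pairField dWaveFormFactor L) *ᵥ v).re ≥ a := by
      rw [ge_iff_le, ← sub_nonneg]
      have : 1 / (L : ℝ) ^ 4 *
          (star v ⬝ᵥ ((pairField dWaveFormFactor L)ᴴ * pairField dWaveFormFactor L) *ᵥ v).re - a =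
          ((star v ⬝ᵥ ((pairField dWaveFormFactor L)ᴴ * pairField dWaveFormFactor L) *ᵥ v).re -
            a * (L : ℝ) ^ 4) / (L : ℝ) ^ 4 := by
        field_simp
      rw [this]
      exact div_nonneg (by linarith) h4.le
    have h1 : 0 < 1 / (L : ℝ) := by positivity
    linarith
  obtain ⟨O, T, c, hc, hT, hid⟩ :=
    exists_certificate_core p H M hHerm hM hinv _ hE hpos u hu1 hu.2.2
  -- re-indexing the KKT generators by `Fin m`
  set w : Fock (Orb (FermionTorus 2 L)) := ((Real.sqrt c : ℝ) : ℂ) • u with hw_def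
  set e := Fintype.equivFin (Finset (Orb (FermionTorus 2 L))) with he_def
  have hsum : ∑ i : Fin (Fintype.card (Finset (Orb (FermionTorus 2 L)))),
      (vecMulVec w (Pi.single (e.symm i) 1))ᴴ *
        (H * vecMulVec w (Pi.single (e.symm i) 1) - vecMulVec w (Pi.single (e.symm i) 1) * H) =
      ∑ j : Finset (Orb (FermionTorus 2 L)), (vecMulVec w (Pi.single j 1))ᴴ *
        (H * vecMulVec w (Pi.single j 1) - vecMulVec w (Pi.single j 1) * H) :=
    Equiv.sum_comp e.symm (fun j => (vecMulVec w (Pi.single j 1))ᴴ *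
        (H * vecMulVec w (Pi.single j 1) - vecMulVec w (Pi.single j 1) * H))
  refine ⟨1, Fintype.card (Finset (Orb (FermionTorus 2 L))), fun _ => O,
    fun i => vecMulVec w (Pi.single (e.symm i) 1), 0, T, ?_, ?_, ?_⟩
  · intro i ψ _
    rw [vecMulVec_mulVec, op_smul_eq_smul]
    exact Submodule.smul_mem _ _ (Submodule.smul_mem _ _ hu.1)
  · intro ψ hψ
    exact hT ψ ((hK ψ).1 hψ)
  · rw [Fin.sum_univ_one, hsum, Matrix.mul_zero, Matrix.zero_mul, sub_zero, add_zero]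
    exact hid

end FunctionFieldCertificate

open FunctionFieldCertificate Literature.MathematicalPhysics.QuantumLattice
  Literature.Barriers.HubbardSuperconductivity in
/-- **Route item `CertificateCompleteness` (stmt-HubbardSuperconductivity-7334).** If at some `(U, δ)`
every normalised `(N_L, S^z = 0)`-sector ground state of `hubbardTorus 2 L 1 U` has
`L⁻⁴ Re⟨ψ, Δ_d†Δ_d ψ⟩ ≥ a > 0` for all even `L ≥ L₀`, then `CertifiedSectorLRO` holds, with the same
`U, δ, a, L₀` and `C = 1`: at each such `L`, `certificate_at` (the sector `N_L = 2⌊(1-δ)L²/2⌋` fits on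
the torus by `natFloor_filling_le_sq`). [folklore] -/
theorem certificateCompleteness_proof :
    Summit.HubbardSuperconductivity.HubbardSuperconductivity.Theses.FunctionFieldCertificate.CertificateCompleteness := by
  unfold Theses.FunctionFieldCertificate.CertificateCompleteness
    Theses.FunctionFieldCertificate.CertifiedSectorLRO
  rintro ⟨U, hU, δ, hδ, a, ha, L₀, hL⟩
  refine ⟨U, hU, δ, hδ, a, 1, ha, L₀, ?_⟩
  intro L _ hL0 hEven
  exact certificate_at U a L _ (natFloor_filling_le_sq (by linarith [hδ.1]) L)
    (fun ψ h1 hgs => hL L hL0 hEven ψ h1 hgs)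

end Summit.HubbardSuperconductivity.HubbardSuperconductivity.Theorems
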